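import Summits.AtomisticToContinuum.Crystallization.Theorems.IsometryAtomsAtomicLawChargesCrystalFiniteOrbitsA

/-!
# Rooted isometry classes: the mass sent / received by a rooted copy (inner Mecke integrals)

Helper file B of stub `stub_finiteOrbitsOfChargedClass` (line `Sketch`, crux `AtomicLawChargesCrystal`,
stmt-AtomisticToContinuum-15778).

For the two-event transport `g(μ, y) = 1_{C_a}(μ) · 1_{C_b}(θ_y μ) · 1{‖y‖ ≤ r}` between the class events
`C_q = {count|A(D − q) : A}` of two roots `a, b` of a separated point set `D ⊆ ℝ³`, the inner (Campbell)
integrals against a rooted copy `μ = count|A(D − a)` are COUNTS of orbit points in balls: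

* `fo_lintegral_sent` — `∫ 1_{C_b}(θ_y μ) 1{‖y‖ ≤ r} μ(dy) = #{s ∈ D : s ∈ Sym(D)·b, dist s a ≤ r}`
  (re-rooting `count|A(D − a)` at its point `A(s − a)` gives `count|A(D − s)`, which lies in `C_b` iff `s`
  is in the orbit of `b`);
* `fo_lintegral_received` — the same count for the integrand of the RIGHT-hand side of the Mecke identity,
  `1_{C_a}(θ_y μ) · 1_{C_b}(θ_{-y} κ θ_y μ) · 1{‖-y‖ ≤ r}` at `μ = count|A(D − b)`, for any map `κ` that is
  the identity on locally finite configurations (the s-finite kernel device of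
  `Literature.Probability.Process.exists_isSFiniteKernel_apply_eq_self`).
-/

noncomputable section

namespace Summit.AtomisticToContinuum.Crystallization.Theorems.IsometryAtomsAtomicLawChargesCrystal

open MeasureTheory Metric Set
open scoped ENNReal

/-! ## Membership of a re-rooted copy in a class event -/

/-- The rooted copy `count|A(D − s)` lies in the class event of the root `b` iff `s` is in the
`Sym(D)`-orbit of `b`. [folklore] -/
theorem fo_rootedCopy_mem_classEvent_iff (D : Set (EuclideanSpace ℝ (Fin 3)))
    (A : EuclideanSpace ℝ (Fin 3) →ₗᵢ[ℝ] EuclideanSpace ℝ (Fin 3)) (b s : EuclideanSpace ℝ (Fin 3)) :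
    (Measure.count : Measure (EuclideanSpace ℝ (Fin 3))).restrict ((fun t => A (t - s)) '' D) ∈
        {μ : Measure (EuclideanSpace ℝ (Fin 3)) | ∃ A' : EuclideanSpace ℝ (Fin 3) →ₗᵢ[ℝ]
          EuclideanSpace ℝ (Fin 3), μ = (Measure.count : Measure (EuclideanSpace ℝ (Fin 3))).restrict
            ((fun t => A' (t - b)) '' D)} ↔
      ∃ g : EuclideanSpace ℝ (Fin 3) ≃ᵃⁱ[ℝ] EuclideanSpace ℝ (Fin 3), g '' D = D ∧ g b = s := by
  constructor
  · intro h
    exact fo_sym_of_mem_classEvent_inter D b s _ h ⟨A, rfl⟩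
  · rintro ⟨g, hg, rfl⟩
    rw [← fo_classEvent_eq_of_sym D g hg b]
    exact ⟨A, rfl⟩

/-! ## Sums of indicators over a rooted copy -/

/-- A `tsum` over the points of a rooted copy `A(D − a)` of a function that, at the point `A(s − a)`,
is the indicator of a set `T ⊆ D` of roots, equals `#T`. [folklore] -/
theorem fo_tsum_rootedCopy_indicator (D T : Set (EuclideanSpace ℝ (Fin 3))) (hT : T ⊆ D)
    (A : EuclideanSpace ℝ (Fin 3) →ₗᵢ[ℝ] EuclideanSpace ℝ (Fin 3)) (a : EuclideanSpace ℝ (Fin 3))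
    (F : EuclideanSpace ℝ (Fin 3) → ℝ≥0∞)
    (hF : ∀ s ∈ D, F (A (s - a)) = T.indicator 1 s) :
    ∑' y : (fun s => A (s - a)) '' D, F y = T.encard := by
  classical
  have hinj : Set.InjOn (fun s => A (s - a)) D := fun s _ t _ hst => by simpa using hst
  -- `F` agrees on the copy with the indicator of the image of `T`
  set W : Set (EuclideanSpace ℝ (Fin 3)) := (fun s => A (s - a)) '' T with hW
  have hWsub : W ⊆ (fun s => A (s - a)) '' D := Set.image_mono hT
  have hFW : ∀ y ∈ (fun s => A (s - a)) '' D, F y = W.indicator 1 y := by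
    rintro _ ⟨s, hs, rfl⟩
    show F (A (s - a)) = W.indicator 1 (A (s - a))
    rw [hF s hs]
    by_cases hsT : s ∈ T
    · rw [indicator_of_mem hsT, indicator_of_mem (s := W) ⟨s, hsT, rfl⟩]
      rfl
    · rw [indicator_of_notMem hsT, indicator_of_notMem]
      rintro ⟨t, ht, hts⟩
      have : t = s := hinj (hT ht) hs hts
      exact hsT (this ▸ ht)
  calc ∑' y : (fun s => A (s - a)) '' D, F y
      = ∑' y : (fun s => A (s - a)) '' D, W.indicator 1 (y : EuclideanSpace ℝ (Fin 3)) :=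
        tsum_congr fun y => hFW y y.2
    _ = ∑' y : EuclideanSpace ℝ (Fin 3), ((fun s => A (s - a)) '' D).indicator (W.indicator 1) y :=
        tsum_subtype ((fun s => A (s - a)) '' D) (W.indicator 1)
    _ = ∑' y : EuclideanSpace ℝ (Fin 3), W.indicator 1 y := by
        rw [indicator_indicator, inter_eq_right.2 hWsub]
    _ = ∑' _ : W, (1 : ℝ≥0∞) := (tsum_subtype W (1 : EuclideanSpace ℝ (Fin 3) → ℝ≥0∞)).symm
    _ = W.encard := ENNReal.tsum_set_one W
    _ = T.encard := by rw [hW, (hinj.mono hT).encard_image]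

/-! ## The mass SENT from the root: `∫ 1_{C_b}(θ_y μ) 1{‖y‖ ≤ r} μ(dy)` for `μ = count|A(D − a)` -/

/-- **Mass sent** by the rooted copy `μ = count|A(D − a)` through the transport
`1_{C_b}(θ_y μ)·1{‖y‖ ≤ r}`: the number of points of the `Sym(D)`-orbit of `b` within distance `r` of
`a`.  (`D` separated so that the copy is countable.) [folklore] -/
theorem fo_lintegral_sent {D : Set (EuclideanSpace ℝ (Fin 3))} {ρ : ℝ} (hρ : 0 < ρ)
    (hD : ∀ x ∈ D, ∀ y ∈ D, x ≠ y → ρ ≤ dist x y)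
    (A : EuclideanSpace ℝ (Fin 3) →ₗᵢ[ℝ] EuclideanSpace ℝ (Fin 3)) (a b : EuclideanSpace ℝ (Fin 3))
    (r : ℝ) :
    ∫⁻ y, {μ : Measure (EuclideanSpace ℝ (Fin 3)) | ∃ A' : EuclideanSpace ℝ (Fin 3) →ₗᵢ[ℝ]
          EuclideanSpace ℝ (Fin 3), μ = (Measure.count : Measure (EuclideanSpace ℝ (Fin 3))).restrict
            ((fun t => A' (t - b)) '' D)}.indicator 1
          (((Measure.count : Measure (EuclideanSpace ℝ (Fin 3))).restrict
            ((fun t => A (t - a)) '' D)).map (fun z => z - y)) *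
        (closedBall (0 : EuclideanSpace ℝ (Fin 3)) r).indicator 1 y
      ∂((Measure.count : Measure (EuclideanSpace ℝ (Fin 3))).restrict ((fun t => A (t - a)) '' D)) =
      ({s | s ∈ D ∧ (∃ g : EuclideanSpace ℝ (Fin 3) ≃ᵃⁱ[ℝ] EuclideanSpace ℝ (Fin 3),
        g '' D = D ∧ g b = s) ∧ dist s a ≤ r}).encard := by
  have hcount : ((fun t => A (t - a)) '' D).Countable :=
    fo_countable_of_separated hρ (fo_rootedCopy_separated hD A a)
  rw [lintegral_countable _ hcount]
  simp only [Measure.count_singleton, mul_one]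
  refine fo_tsum_rootedCopy_indicator D {s | s ∈ D ∧ (∃ g : EuclideanSpace ℝ (Fin 3) ≃ᵃⁱ[ℝ]
    EuclideanSpace ℝ (Fin 3), g '' D = D ∧ g b = s) ∧ dist s a ≤ r} (fun s hs => hs.1) A a
    (fun y => {μ : Measure (EuclideanSpace ℝ (Fin 3)) | ∃ A' : EuclideanSpace ℝ (Fin 3) →ₗᵢ[ℝ]
          EuclideanSpace ℝ (Fin 3), μ = (Measure.count : Measure (EuclideanSpace ℝ (Fin 3))).restrict
            ((fun t => A' (t - b)) '' D)}.indicator 1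
          (((Measure.count : Measure (EuclideanSpace ℝ (Fin 3))).restrict
            ((fun t => A (t - a)) '' D)).map (fun z => z - y)) *
        (closedBall (0 : EuclideanSpace ℝ (Fin 3)) r).indicator 1 y)
    fun s hs => ?_
  -- evaluate the integrand at the point `A (s - a)`
  have hball : A (s - a) ∈ closedBall (0 : EuclideanSpace ℝ (Fin 3)) r ↔ dist s a ≤ r := by
    rw [mem_closedBall_zero_iff, A.norm_map, ← dist_eq_norm]
  show _ = ({s | s ∈ D ∧ (∃ g : EuclideanSpace ℝ (Fin 3) ≃ᵃⁱ[ℝ] EuclideanSpace ℝ (Fin 3),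
    g '' D = D ∧ g b = s) ∧ dist s a ≤ r}).indicator 1 s
  rw [fo_map_sub_rootedCopy D A a s]
  by_cases horb : ∃ g : EuclideanSpace ℝ (Fin 3) ≃ᵃⁱ[ℝ] EuclideanSpace ℝ (Fin 3), g '' D = D ∧ g b = s
  · rw [indicator_of_mem ((fo_rootedCopy_mem_classEvent_iff D A b s).2 horb)]
    by_cases hr : dist s a ≤ r
    · rw [indicator_of_mem (hball.2 hr), indicator_of_mem
        (s := {s | s ∈ D ∧ (∃ g : EuclideanSpace ℝ (Fin 3) ≃ᵃⁱ[ℝ] EuclideanSpace ℝ (Fin 3),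
          g '' D = D ∧ g b = s) ∧ dist s a ≤ r}) ⟨hs, horb, hr⟩]
      simp
    · rw [indicator_of_notMem (fun h => hr (hball.1 h)), indicator_of_notMem
        (s := {s | s ∈ D ∧ (∃ g : EuclideanSpace ℝ (Fin 3) ≃ᵃⁱ[ℝ] EuclideanSpace ℝ (Fin 3),
          g '' D = D ∧ g b = s) ∧ dist s a ≤ r}) (fun h => hr h.2.2)]
      simp
  · rw [indicator_of_notMem (fun h => horb ((fo_rootedCopy_mem_classEvent_iff D A b s).1 h)),
      indicator_of_notMem
        (s := {s | s ∈ D ∧ (∃ g : EuclideanSpace ℝ (Fin 3) ≃ᵃⁱ[ℝ] EuclideanSpace ℝ (Fin 3),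
          g '' D = D ∧ g b = s) ∧ dist s a ≤ r}) (fun h => horb h.2.1)]
    simp

/-! ## The mass RECEIVED at the root (right-hand side of the Mecke identity) -/

/-- Re-rooting and rooting back: `θ_{-y} (θ_y μ) = μ`. [folklore] -/
theorem fo_map_sub_map_sub_neg (μ : Measure (EuclideanSpace ℝ (Fin 3))) (y : EuclideanSpace ℝ (Fin 3)) :
    (μ.map (fun z => z - y)).map (fun z => z - -y) = μ := by
  rw [Measure.map_map (measurable_sub_const _) (measurable_sub_const _)]
  have : ((fun z : EuclideanSpace ℝ (Fin 3) => z - -y) ∘ fun z => z - y) = id := by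
    funext z; simp
  rw [this, Measure.map_id]

/-- **Mass received** at the root of the rooted copy `μ = count|A(D − b)` through the reflected transport
`1_{C_a}(θ_y μ) · 1_{C_b}(θ_{-y} κ (θ_y μ)) · 1{‖-y‖ ≤ r}`, where `κ` fixes locally finite configurations:
the number of points of the `Sym(D)`-orbit of `a` within distance `r` of `b`. [folklore] -/
theorem fo_lintegral_received {D : Set (EuclideanSpace ℝ (Fin 3))} {ρ : ℝ} (hρ : 0 < ρ)
    (hD : ∀ x ∈ D, ∀ y ∈ D, x ≠ y → ρ ≤ dist x y)
    (κ : Measure (EuclideanSpace ℝ (Fin 3)) → Measure (EuclideanSpace ℝ (Fin 3)))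
    (hκ : ∀ ν : Measure (EuclideanSpace ℝ (Fin 3)),
      (∀ n : ℕ, ν ((fun z : EuclideanSpace ℝ (Fin 3) => ⌊‖z‖⌋₊) ⁻¹' {n}) < ⊤) → κ ν = ν)
    (A : EuclideanSpace ℝ (Fin 3) →ₗᵢ[ℝ] EuclideanSpace ℝ (Fin 3)) (a b : EuclideanSpace ℝ (Fin 3))
    (r : ℝ) :
    ∫⁻ y, {μ : Measure (EuclideanSpace ℝ (Fin 3)) | ∃ A' : EuclideanSpace ℝ (Fin 3) →ₗᵢ[ℝ]
          EuclideanSpace ℝ (Fin 3), μ = (Measure.count : Measure (EuclideanSpace ℝ (Fin 3))).restrict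
            ((fun t => A' (t - a)) '' D)}.indicator 1
          (((Measure.count : Measure (EuclideanSpace ℝ (Fin 3))).restrict
            ((fun t => A (t - b)) '' D)).map (fun z => z - y)) *
        ({μ : Measure (EuclideanSpace ℝ (Fin 3)) | ∃ A' : EuclideanSpace ℝ (Fin 3) →ₗᵢ[ℝ]
          EuclideanSpace ℝ (Fin 3), μ = (Measure.count : Measure (EuclideanSpace ℝ (Fin 3))).restrict
            ((fun t => A' (t - b)) '' D)}.indicator 1
          ((κ (((Measure.count : Measure (EuclideanSpace ℝ (Fin 3))).restrict
            ((fun t => A (t - b)) '' D)).map (fun z => z - y))).map (fun z => z - -y)) *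
        (closedBall (0 : EuclideanSpace ℝ (Fin 3)) r).indicator 1 (-y))
      ∂((Measure.count : Measure (EuclideanSpace ℝ (Fin 3))).restrict ((fun t => A (t - b)) '' D)) =
      ({s | s ∈ D ∧ (∃ g : EuclideanSpace ℝ (Fin 3) ≃ᵃⁱ[ℝ] EuclideanSpace ℝ (Fin 3),
        g '' D = D ∧ g a = s) ∧ dist s b ≤ r}).encard := by
  rw [← fo_lintegral_sent hρ hD A b a r]
  have hcount : ((fun t => A (t - b)) '' D).Countable :=
    fo_countable_of_separated hρ (fo_rootedCopy_separated hD A b)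
  rw [lintegral_countable _ hcount, lintegral_countable _ hcount]
  refine tsum_congr fun y => ?_
  obtain ⟨s, hs, hys⟩ : ∃ s ∈ D, A (s - b) = y := y.2
  simp only [← hys]
  -- the re-rooted copy is locally finite, so `κ` fixes it and rooting back returns `μ`
  have hmem : (Measure.count : Measure (EuclideanSpace ℝ (Fin 3))).restrict ((fun t => A (t - b)) '' D) ∈
      {μ : Measure (EuclideanSpace ℝ (Fin 3)) | ∃ A' : EuclideanSpace ℝ (Fin 3) →ₗᵢ[ℝ]
        EuclideanSpace ℝ (Fin 3), μ = (Measure.count : Measure (EuclideanSpace ℝ (Fin 3))).restrict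
          ((fun t => A' (t - b)) '' D)} := ⟨A, rfl⟩
  rw [fo_map_sub_rootedCopy D A b s, hκ _ (fo_rootedCopy_shell_lt_top hρ hD A s),
    ← fo_map_sub_rootedCopy D A b s, fo_map_sub_map_sub_neg,
    indicator_of_mem (s := {μ : Measure (EuclideanSpace ℝ (Fin 3)) | ∃ A' : EuclideanSpace ℝ (Fin 3) →ₗᵢ[ℝ]
        EuclideanSpace ℝ (Fin 3), μ = (Measure.count : Measure (EuclideanSpace ℝ (Fin 3))).restrict
          ((fun t => A' (t - b)) '' D)}) hmem]
  have hball : (closedBall (0 : EuclideanSpace ℝ (Fin 3)) r).indicator (1 : EuclideanSpace ℝ (Fin 3) → ℝ≥0∞)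
      (-A (s - b)) = (closedBall (0 : EuclideanSpace ℝ (Fin 3)) r).indicator 1 (A (s - b)) := by
    by_cases h : A (s - b) ∈ closedBall (0 : EuclideanSpace ℝ (Fin 3)) r
    · have h' : -A (s - b) ∈ closedBall (0 : EuclideanSpace ℝ (Fin 3)) r := by
        rwa [mem_closedBall_zero_iff, norm_neg, ← mem_closedBall_zero_iff]
      rw [indicator_of_mem h, indicator_of_mem h']
      rfl
    · have h' : -A (s - b) ∉ closedBall (0 : EuclideanSpace ℝ (Fin 3)) r := by
        rwa [mem_closedBall_zero_iff, norm_neg, ← mem_closedBall_zero_iff]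
      rw [indicator_of_notMem h, indicator_of_notMem h']
  rw [hball]
  simp only [Pi.one_apply, one_mul]

/-- **Registered sub-goal B of stub `stub_finiteOrbitsOfChargedClass`** (binder-free packaging of
`fo_map_sub_map_sub_neg` for the ledger's stub registry): rooting back a re-rooted configuration returns it.
[folklore] -/
theorem fo_subgoalB_mapSubMapSubNeg : ∀ (μ : MeasureTheory.Measure (EuclideanSpace ℝ (Fin 3))) (y : EuclideanSpace ℝ (Fin 3)), (μ.map (fun z => z - y)).map (fun z => z - -y) = μ :=
  fun μ y => fo_map_sub_map_sub_neg μ y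

end Summit.AtomisticToContinuum.Crystallization.Theorems.IsometryAtomsAtomicLawChargesCrystal

end
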